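import Literature.Algebra.EuclideanLattices.MRLemma510Function
import Literature.Algebra.EuclideanLattices.DualGridSolverAdapter
import Literature.Probability.Distributions.IndepProductLawDistance
import Literature.Probability.Distributions.PseudoGaussianSamplerParams
import Literature.Algebra.EuclideanLattices.DualGridGuesses
import Literature.Computability.Cryptography.IncGDDToSISAnalysis
import Literature.Computability.Cryptography.SISOracleKernel
import Literature.Computability.Cryptography.LWERegevAsymptotics
import HarnessLib

/-!
# MR07 Thm. 5.9, one attempt on a general integer lattice: the model's data, the machine's parameters, and the success bound from the machine's law

Topic `Algebra/EuclideanLattices` (family `pqc`). This file closes, up to the construction of the machine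
itself, the hypothesis `H59a` of `MRThm59Shell.owfExist_of_gapSVP_worstCaseHard_of_incGDDAttempt` (the
verifier-free route to `Literature.Computability.Cryptography.owfExist_of_gapSVP_worstCaseHard`): a PPT
attempt `Att` that, given a well-formed `IncGDD` instance `J = (n, U, V, t, r)` in the wire format of
`MRLemma510Function.lean` and a guess, answers with probability `≥ 1/n^e`. One attempt of
Micciancio–Regev 2007, Thm. 5.9 (authors' version pp. 22–24) has been analysed on the integer fine grid for
a PRIMAL matrix `B` (`DualGridAttemptSuccess.toReal_naturalAttempt_success_ge`: lattice `Λ' = G ℤⁿ`,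
`G = invMatrix B`, rows `S ⊂ Λ'`, shifts `Tsh`, grid `(1/N)ℤⁿ`, exact Gaussians `D_{ℤ,Ns,0}`, any oracle
kernel). For a GENERAL nonsingular `U` the model is run on `B_U = invMatrix Uᵀ`
(`DualGridSolverAdapter.lean`: `Λ' = c_U · L(U)`, `c_U = det(U)^{4n−4}`), i.e. on the instance SCALED by
`c = c_U`, and the output `u' ∈ Λ'` is read back as the coefficient row `z = B_U u'/Dg`, `z U = u'/c`.
Proved here, in three layers:

**Data** (definitions with bodies): `Umat`, `Smod` (`c · V`), `TshOf` (`Tsh_{j₀} = −(sign α · c · N₁) tw`,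
others `0`), `NOf` (`N = N₁|α|td`, so that `−N c t/α` is integral), `zOf`; `dualLat_BU_eq` (`Λ' = c·L(U)`),
`Smod_mem`, `Smod_li`, `norm_rowVec_le_maxNorm`, `norm_Smod_le`, `sum_smul_fineGridVec_TshOf` (the model's
`htv`: `∑ zᵢ Tshᵢ/N = −c t` when `z_{j₀} = α`), `tvDist_naturalAttemptWith_le` /
`toReal_naturalAttemptWith_ge_sub` (changing the one-dimensional sampler law moves every event by
`≤ m·n·Δ`, Goldreich §3.2), `rawE_zOf_mem_goodAnswers` (an output within `c(‖S‖/8 + r)` of `c t` reads as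
a good answer, MR07 Def. 5.6 with `g = 8`), **`toReal_naturalAttemptWith_goodAnswers_ge`** (the model's bound
transferred, for a width `2cη ≤ s ≤ 2cr/(β√n)`, `q ≥ 4√m n√n β`, `n ≥ 4`).

**Parameters** a machine computes exactly: `eOf n = n + rOf n + 3`, `N2Of = q·2^e`, `N1Of = N2Of·rd·βup·n`,
`XOf = c·rn·N2Of·|α|·td (= c r N/(βup n))`, the mesh exponent `bOf = log₂ X`, the width `sOf = 2ᵇ√π/N`
(so `N s = 2ᵇ√π`, the width of the coin-driven sampler `PGParams.std n b`), the box length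
`ellOf = size dT + size n + n`; the inequalities `q_le_NOf`, `slackN_le`, `slackT_le`, `slackE_le` (each
slack `≤ 2⁻ⁿ`-sized), `le_bOf` (`n + rOf n + 1 ≤ b`), `sOf_hi` (`sβ√n/2 ≤ c r` for `β ≤ βup`), **`sOf_lo`**
(`2c·η_{2⁻ⁿ}(L(U)) ≤ s` from the PROMISE `r > 3 βup n · η_{2⁻ⁿ}(L(U))`, `3 > 4/√π`), `NOf_mul_sOf`, and
**`toReal_attempt_goodAnswers_ge_of_promise`**: with any coordinate sampler law within `τ` of `D_{ℤ,Ns,0}`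
and any oracle kernel, `Pr[good answer] ≥ (δ_{j₀,α} − 4m·2⁻ⁿ)/3 − m n τ`.

**Assembly**: `mul_toReal_bind_pair_le` (kernel domination, event form), `decKernel`, `guessIdx`
(`i = j₀·2β̂ + a`), `one_le_beta_of_successProb'_pos`, `exists_guess_kernelEvent` (the GUESS of step 1,
`SIS.exists_guess`: `δ_{j,α} ≥ δ/(2βm)`, transported to a kernel dominating `θ·` the solver's law),
`hnum_of_le` (`1/(2π) + ε/(1−ε) + (ε/(1−ε))²m ≤ 1/6` for `n ≥ 9`, `4m ≤ 2ⁿ`), and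
**`attempt_success_of_law`** — the success clause of `H59a` for ANY machine `Att` whose output law on
`⟨J, ⟨1ⁱ, w⟩⟩` is the model run with these parameters, a sampler law `D p J α` within `20/(p(n)+1)` of exact
for large `n` (the machine family being indexed by the precision polynomial `p`: a coin-driven sampler reaches
precision `2⁻ᵏ` with `2ᵏ·poly` coins, so `k = O(log n)`) and the oracle kernel of a string kernel dominating
`2^{−W(n)}·` the law of `B` (the guessed-coin call, `GuessedCoinCall.le_toReal_callLaw`), read through `zOf`:
for some precision `p` there are `G`, `e`, `n₀` with success `≥ 1/n^e` for some guess `i < G(n)` on every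
well-formed promise instance of dimension `n ∈ S`, `n ≥ n₀` (losses `2βm`, `2^W`, `n^c`, the slack
`2⁻ⁿ·poly` and the sampler's `20 m n/(p(n)+1)` absorbed: `IsPolyBounded.eventually_le_pow`,
`eventually_mul_pow_le_two_pow`).

No named fact; every definition has a body.

## References

* D. Micciancio, O. Regev, *Worst-case to average-case reductions based on Gaussian measures*,
  SIAM J. Comput. 37 (2007) 267–302; authors' version, Thm. 5.9 and its proof (pp. 22–24), Def. 5.6,
  Lemma 5.7 [MicciancioRegev2007].
* D. Micciancio, S. Goldwasser, *Complexity of Lattice Problems*, Kluwer 2002, Ch. 1 §1 (integer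
  lattices, `L(B)* = L((B⁻¹)ᵀ)`) [MicciancioGoldwasser2002].
* O. Goldreich, *Foundations of Cryptography I*, CUP 2001, §1.3.2 (invoking a PPT subroutine at polynomial
  loss), §3.2 (statistical distance: hybrid argument, data processing) [Goldreich2001].
-/

noncomputable section

open scoped Classical ENNReal Real Pointwise

namespace Literature.Algebra.EuclideanLattices

open Module Submodule Matrix GSInverse Finset Literature.Probability.Distributions PMF MeasureTheory Filter Polynomial
  MRLemma510 DualGrid Literature.Computability.Complexity Literature.Computability.Complexity.CodeFP
  Literature.Computability.Complexity.LMat Literature.Computability.Cryptography Literature.Computability.Cryptography.SIS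
  Literature.Computability.Cryptography.LWE Literature.Computability.Cryptography.LWE.RegevReduction

namespace MRThm59

variable (J : IncGDDInst)

/-! ### The data of the model -/

/-- The basis matrix `U` of `Λ = L(U)`. [cite: MicciancioRegev2007, Def. 5.6] -/
def Umat : Matrix (Fin J.n) (Fin J.n) ℤ := toMat J.n J.n J.U

/-- **The scaled rows `S'ⱼ = c · vⱼ`** (`c = c_U`). [cite: MicciancioRegev2007, Thm. 5.9 (input S)] -/
def Smod : Fin J.n → Fin J.n → ℤ := fun j i => cU (Umat J) * toMat J.n J.n J.V j i

/-- **The shifts of the samples**: `Tsh_{j₀} = -(sign α · c · N₁) · tw`, the others `0`, so that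
`∑ zᵢ Tshᵢ/N = -c t` whenever `z_{j₀} = α` (`N = N₁ |α| td`, `t = tw/td`).
[cite: MicciancioRegev2007, Thm. 5.9 (step 2: "t_j = -t/α and t_i = 0 otherwise")] -/
def TshOf (m : ℕ) (j₀ : Fin m) (α : ℤ) (N₁ : ℕ) : Fin m → Fin J.n → ℤ :=
  fun i t => if i = j₀ then -(Int.sign α * cU (Umat J) * N₁) * J.tw.getD t 0 else 0

/-- **The fine-grid parameter `N = N₁ · |α| · td`.** [folklore] -/
def NOf (α : ℤ) (N₁ : ℕ) : ℕ := N₁ * α.natAbs * J.td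

/-- **The coefficient row read off an output `u' ∈ Λ'`**: `z = B_U u'/Dg`. [cite: MicciancioGoldwasser2002, Ch. 1 §1] -/
def zOf (u : Fin J.n → ℤ) : List ℤ := List.ofFn fun k => (BU (Umat J) *ᵥ u) k / Dg (BU (Umat J))

variable {J}

/-! ### The lattice of the model is `c · L(U)` -/

/-- `det U ≠ 0`. [folklore] -/
theorem det_Umat_ne (hJ : J.WellFormed) : (Umat J).det ≠ 0 := hJ.det_U

/-- `c > 0` in `ℝ`. [folklore] -/
theorem cR_pos (hJ : J.WellFormed) : (0 : ℝ) < cU (Umat J) := by exact_mod_cast cU_pos (det_Umat_ne hJ)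

/-- The lattice of `J` is that of the instance `(n, U)`. [folklore] -/
theorem lattice_eq_inst : J.lattice = (⟨J.n, Umat J⟩ : LatticeInstance).lattice := rfl

/-- `intVecToEuclidean (c • v) = c • intVecToEuclidean v`. [folklore] -/
theorem intVecToEuclidean_zsmul (n : ℕ) (c : ℤ) (v : Fin n → ℤ) :
    intVecToEuclidean n (c • v) = (c : ℝ) • intVecToEuclidean n v := by
  rw [map_zsmul, Int.cast_smul_eq_zsmul]

/-- **`Λ' = c · L(U)`** as submodules. [cite: MicciancioGoldwasser2002, Ch. 1 §1] -/
theorem dualLat_BU_eq (hJ : J.WellFormed) : dualLat (BU (Umat J)) = (cU (Umat J) : ℝ) • J.lattice := by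
  have hc : (cU (Umat J) : ℝ) ≠ 0 := (cR_pos hJ).ne'
  ext x
  rw [mem_dualLat_BU_iff (det_Umat_ne hJ), ← lattice_eq_inst, Submodule.mem_smul_pointwise_iff_exists]
  constructor
  · intro h
    exact ⟨_, h, by rw [smul_smul, mul_inv_cancel₀ hc, one_smul]⟩
  · rintro ⟨y, hy, rfl⟩
    rwa [smul_smul, inv_mul_cancel₀ hc, one_smul]

/-- `η_ε(Λ') = c · η_ε(L(U))` on the `J.lattice` spelling. [cite: MicciancioRegev2007, Def. 3.1 (homogeneity)] -/
theorem smoothingParameter_dualLat_BU_J (hJ : J.WellFormed) (ε : ℝ) :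
    smoothingParameter (dualLat (BU (Umat J))) ε = cU (Umat J) * smoothingParameter J.lattice ε :=
  smoothingParameter_dualLat_BU (det_Umat_ne hJ) ε

/-! ### The scaled rows -/

/-- `S'ⱼ = c · vⱼ` in `ℝⁿ`. [folklore] -/
theorem intVecToEuclidean_Smod (j : Fin J.n) :
    intVecToEuclidean J.n (Smod J j) = (cU (Umat J) : ℝ) • IncGDDInst.rowVec J.n J.V j := by
  have h : Smod J j = cU (Umat J) • (fun i => toMat J.n J.n J.V j i) := by
    funext i; simp [Smod]
  rw [h, intVecToEuclidean_zsmul]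
  rfl

/-- **`S'ⱼ ∈ Λ'`.** [cite: MicciancioRegev2007, Def. 5.6 (S ⊂ L(B))] -/
theorem Smod_mem (hJ : J.WellFormed) (j : Fin J.n) : intVecToEuclidean J.n (Smod J j) ∈ dualLat (BU (Umat J)) := by
  rw [intVecToEuclidean_Smod, dualLat_BU_eq hJ]
  exact Submodule.smul_mem_pointwise_smul _ _ _ (hJ.mem_V j j.isLt)

/-- **The `S'ⱼ` are linearly independent.** [cite: MicciancioRegev2007, Def. 5.6] -/
theorem Smod_li (hJ : J.WellFormed) : LinearIndependent ℝ fun j => intVecToEuclidean J.n (Smod J j) := by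
  have h : (fun j => intVecToEuclidean J.n (Smod J j)) =
      (fun _ : Fin J.n => Units.mk0 (cU (Umat J) : ℝ) (cR_pos hJ).ne') • fun j : Fin J.n => IncGDDInst.rowVec J.n J.V j := by
    funext j
    rw [Pi.smul_apply', intVecToEuclidean_Smod]
    rfl
  rw [h]
  exact hJ.indep_V.units_smul _

/-- **Every row is bounded by `‖S‖`**: `‖vⱼ‖ ≤ ‖S‖ = √(max ‖vᵢ‖²)`. [cite: MicciancioRegev2007, §5 (notation ‖S‖)] -/
theorem norm_rowVec_le_maxNorm (hJ : J.WellFormed) (j : Fin J.n) : ‖IncGDDInst.rowVec J.n J.V j‖ ≤ J.maxNorm := by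
  have hjV : (j : ℕ) < J.V.length := by rw [hJ.len_V]; exact j.isLt
  have hne : sqNorms J.V ≠ [] := by
    intro h
    have : (sqNorms J.V).length = 0 := by rw [h]; rfl
    rw [sqNorms, List.length_map] at this
    omega
  obtain ⟨-, hmax⟩ := argmaxZ_spec hne
  have hle : sqNormZ (J.V.getD j []) ≤ J.maxSqNorm := by
    have := hmax j (by rw [sqNorms, List.length_map]; exact hjV)
    rwa [getD_sqNorms _ hjV] at this
  have hlen : (J.V.getD (j : ℕ) []).length ≤ J.n := by
    rw [List.getD_eq_getElem _ _ hjV]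
    exact (hJ.row_V _ (List.getElem_mem hjV)).le
  have hsq : ‖IncGDDInst.rowVec J.n J.V j‖ ^ 2 ≤ (J.maxSqNorm : ℝ) := by
    rw [rowVec_eq_vecOf, ← cast_sqNormZ hlen]
    exact_mod_cast hle
  calc ‖IncGDDInst.rowVec J.n J.V j‖ = Real.sqrt (‖IncGDDInst.rowVec J.n J.V j‖ ^ 2) := (Real.sqrt_sq (norm_nonneg _)).symm
    _ ≤ Real.sqrt J.maxSqNorm := Real.sqrt_le_sqrt hsq

/-- `‖S‖ ≥ 0`. [folklore] -/
theorem maxNorm_nonneg (J : IncGDDInst) : 0 ≤ J.maxNorm := Real.sqrt_nonneg _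

/-- **`‖S'ⱼ‖ ≤ c ‖S‖`.** [folklore] -/
theorem norm_Smod_le (hJ : J.WellFormed) (j : Fin J.n) : ‖intVecToEuclidean J.n (Smod J j)‖ ≤ cU (Umat J) * J.maxNorm := by
  rw [intVecToEuclidean_Smod, norm_smul, Real.norm_eq_abs, abs_of_pos (cR_pos hJ)]
  exact mul_le_mul_of_nonneg_left (norm_rowVec_le_maxNorm hJ j) (cR_pos hJ).le

/-! ### The shifts -/

/-- `N > 0` for `N₁ > 0`, `α ≠ 0` (and `td > 0`). [folklore] -/
theorem NOf_pos (hJ : J.WellFormed) {α : ℤ} (hα : α ≠ 0) {N₁ : ℕ} (hN₁ : 0 < N₁) : 0 < NOf J α N₁ :=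
  Nat.mul_pos (Nat.mul_pos hN₁ (Int.natAbs_pos.2 hα)) hJ.td_pos

/-- **The hypothesis `htv` of the model**: `∑ᵢ zᵢ · Tshᵢ/N = -c · t` whenever `z_{j₀} = α`.
[cite: MicciancioRegev2007, Thm. 5.9 (step 2 and p. 23: "∑ zᵢ tᵢ = -t")] -/
theorem sum_smul_fineGridVec_TshOf (hJ : J.WellFormed) {m : ℕ} (j₀ : Fin m) {α : ℤ} (hα : α ≠ 0) {N₁ : ℕ} (hN₁ : 0 < N₁)
    (z : Fin m → ℤ) (hz : z j₀ = α) :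
    ∑ i, (z i : ℝ) • fineGridVec J.n (NOf J α N₁) (TshOf J m j₀ α N₁ i) = -((cU (Umat J) : ℝ) • J.target) := by
  rw [Finset.sum_eq_single j₀ (fun i _ hi => by
      have h0 : TshOf J m j₀ α N₁ i = 0 := by funext t; simp [TshOf, hi]
      rw [h0, fineGridVec, map_zero, smul_zero, smul_zero]) (fun h => (h (Finset.mem_univ _)).elim)]
  rw [hz]
  have hN : ((NOf J α N₁ : ℕ) : ℝ) = (N₁ : ℝ) * |(α : ℝ)| * J.td := by
    rw [NOf, Nat.cast_mul, Nat.cast_mul, Nat.cast_natAbs, Int.cast_abs]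
  have hN₁ : (N₁ : ℝ) ≠ 0 := by exact_mod_cast hN₁.ne'
  have hα' : (α : ℝ) ≠ 0 := by exact_mod_cast hα
  have htd : (J.td : ℝ) ≠ 0 := by exact_mod_cast hJ.td_pos.ne'
  have hsign : (α : ℝ) * (Int.sign α : ℝ) = |(α : ℝ)| := by
    rw [← Int.cast_mul, Int.mul_sign_self, Int.natCast_natAbs, Int.cast_abs]
  ext t
  simp only [PiLp.smul_apply, fineGridVec_apply, PiLp.neg_apply, IncGDDInst.target, IncGDDInst.vecOf, intVecToEuclidean_apply,
    smul_eq_mul, TshOf, if_true]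
  push_cast
  rw [hN]
  field_simp
  have habs : |(α : ℝ)| ≠ 0 := abs_ne_zero.2 hα'
  rw [← hsign]
  ring

/-! ### Reading the output -/

/-- The coefficient row of `u' = G' w` is `w`. [folklore] -/
theorem zOf_G_mulVec (hJ : J.WellFormed) (w : Fin J.n → ℤ) : zOf J (G (BU (Umat J)) *ᵥ w) = List.ofFn w := by
  have hB := det_BU_ne_zero (det_Umat_ne hJ)
  have hD : Dg (BU (Umat J)) ≠ 0 := (Dg_pos hB).ne'
  unfold zOf
  congr 1
  funext k
  rw [B_mulVec_G_mulVec hB, Pi.smul_apply, smul_eq_mul, Int.mul_ediv_cancel_left _ hD]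

/-- `readVec` of the answer is the coefficient row, of length `n`. [folklore] -/
theorem readVec_rawE_zOf (u : Fin J.n → ℤ) : readVec (rawE intE (zOf J u)) = zOf J u := readVec_rawE _

/-- `vecMulZ` of an `ofFn` row is the lattice vector with those coefficients. [folklore] -/
theorem vecOf_vecMulZ_ofFn (w : Fin J.n → ℤ) :
    IncGDDInst.vecOf J.n (vecMulZ J.n (List.ofFn w) J.U) = intVecToEuclidean J.n (w ᵥ* Umat J) := by
  rw [vecOf_vecMulZ]
  have h : (fun i : Fin J.n => (List.ofFn w).getD (i : ℕ) 0) = w := by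
    funext i
    rw [List.getD_eq_getElem _ _ (by simp), List.getElem_ofFn]
  rw [h]
  rfl

/-- **An output of the model within `c(‖S‖/8 + r)` of `c t` reads as a good answer of `J`**
(`u' = G' w = c · wU`, so `‖wU − t‖ = ‖u' − ct‖/c`). [cite: MicciancioRegev2007, Def. 5.6 (‖s − t‖ ≤ ‖S‖/g + r, g = 8)] -/
theorem rawE_zOf_mem_goodAnswers (hJ : J.WellFormed) {u : Fin J.n → ℤ} (hu : intVecToEuclidean J.n u ∈ dualLat (BU (Umat J)))
    {bnd : ℝ} (hdist : ‖intVecToEuclidean J.n u - (cU (Umat J) : ℝ) • J.target‖ ≤ bnd)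
    (hbnd : bnd ≤ cU (Umat J) * (J.maxNorm / 8 + J.radius)) : rawE intE (zOf J u) ∈ J.goodAnswers := by
  have hc := cR_pos hJ
  have hU := det_Umat_ne hJ
  obtain ⟨w, hw⟩ := (mem_dualLat_iff (BU (Umat J)) _).1 hu
  have hwu : G (BU (Umat J)) *ᵥ w = u := intVecToEuclidean_injective _ hw
  subst hwu
  refine ⟨by rw [readVec_rawE_zOf, zOf_G_mulVec hJ, List.length_ofFn], ?_⟩
  rw [readVec_rawE_zOf, zOf_G_mulVec hJ, vecOf_vecMulZ_ofFn]
  have hwU : intVecToEuclidean J.n (w ᵥ* Umat J) = (cU (Umat J) : ℝ)⁻¹ • intVecToEuclidean J.n (G (BU (Umat J)) *ᵥ w) := by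
    rw [G_BU_mulVec hU, intVecToEuclidean_zsmul, smul_smul, inv_mul_cancel₀ hc.ne', one_smul]
  rw [hwU]
  have hscale : (cU (Umat J) : ℝ)⁻¹ • intVecToEuclidean J.n (G (BU (Umat J)) *ᵥ w) - J.target =
      (cU (Umat J) : ℝ)⁻¹ • (intVecToEuclidean J.n (G (BU (Umat J)) *ᵥ w) - (cU (Umat J) : ℝ) • J.target) := by
    rw [smul_sub, smul_smul, inv_mul_cancel₀ hc.ne', one_smul]
  rw [hscale, norm_smul, Real.norm_eq_abs, abs_of_pos (inv_pos.2 hc)]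
  calc (cU (Umat J) : ℝ)⁻¹ * ‖intVecToEuclidean J.n (G (BU (Umat J)) *ᵥ w) - (cU (Umat J) : ℝ) • J.target‖
      ≤ (cU (Umat J) : ℝ)⁻¹ * (cU (Umat J) * (J.maxNorm / 8 + J.radius)) :=
        mul_le_mul_of_nonneg_left (hdist.trans hbnd) (inv_pos.2 hc).le
    _ = J.maxNorm / 8 + J.radius := by field_simp

/-! ### Changing the sampler law -/

/-- The grid noise with two coordinate laws: `Δ ≤ n · Δ(D, D')`. [cite: Goldreich2001, §3.2 (Thm. 3.2.6)] -/
private theorem tvDist_gridNoiseWith_le' {n : ℕ} (D D' : PMF ℤ) (T : Fin n → ℤ) :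
    (gridNoiseWith D T).tvDist (gridNoiseWith D' T) ≤ n * D.tvDist D' := by
  rw [gridNoiseWith, gridNoiseWith]
  refine (PMF.tvDist_map_le_holds _ _ _).trans ?_
  refine (tvDist_indepLaw_le n (fun _ => D) (fun _ => D')).trans ?_
  rw [Finset.sum_const, Finset.card_univ, Fintype.card_fin, nsmul_eq_mul]

/-- **The attempt with two sampler laws**: `Δ ≤ m · n · Δ(D, D')` (hybrid over the `m` independent
noises, then kernel contraction for the rest of the attempt). [cite: Goldreich2001, §3.2 (Thm. 3.2.6 and data processing)] -/
theorem tvDist_naturalAttemptWith_le {n : ℕ} (B : Matrix (Fin n) (Fin n) ℤ) (N : ℕ) (S : Fin n → Fin n → ℤ) {m q : ℕ}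
    (D D' : PMF ℤ) (O : Matrix (Fin n) (Fin m) (ZMod q) → PMF (Fin m → ℤ)) (Tsh : Fin m → Fin n → ℤ) (ℓ : ℕ) :
    (naturalAttemptWith B N S D O Tsh ℓ).tvDist (naturalAttemptWith B N S D' O Tsh ℓ) ≤ m * (n * D.tvDist D') := by
  rw [naturalAttemptWith, naturalAttemptWith]
  refine (PMF.tvDist_bind_left_le _ _ _).trans ?_
  refine (tvDist_indepLaw_le m _ _).trans ?_
  calc ∑ i, (gridNoiseWith D (Tsh i)).tvDist (gridNoiseWith D' (Tsh i)) ≤ ∑ _i : Fin m, (n * D.tvDist D') :=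
        Finset.sum_le_sum fun i _ => tvDist_gridNoiseWith_le' D D' (Tsh i)
    _ = m * (n * D.tvDist D') := by rw [Finset.sum_const, Finset.card_univ, Fintype.card_fin, nsmul_eq_mul]

/-- **Every event of the attempt moves by at most `m · n · Δ(D, D')` when the sampler law changes**:
`Pr_{D'}[E] ≥ Pr_{D}[E] − m · n · Δ(D, D')`. [cite: Goldreich2001, §3.2 (every event moves by at most Δ)] -/
theorem toReal_naturalAttemptWith_ge_sub {n : ℕ} (B : Matrix (Fin n) (Fin n) ℤ) (N : ℕ) (S : Fin n → Fin n → ℤ) {m q : ℕ}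
    (D D' : PMF ℤ) (O : Matrix (Fin n) (Fin m) (ZMod q) → PMF (Fin m → ℤ)) (Tsh : Fin m → Fin n → ℤ) (ℓ : ℕ) (E : Set (Fin n → ℤ)) :
    ((naturalAttemptWith B N S D O Tsh ℓ).toOuterMeasure E).toReal - m * (n * D.tvDist D') ≤
      ((naturalAttemptWith B N S D' O Tsh ℓ).toOuterMeasure E).toReal := by
  have h := abs_toReal_toOuterMeasure_sub_le_tvDist (naturalAttemptWith B N S D O Tsh ℓ) (naturalAttemptWith B N S D' O Tsh ℓ) E
  have h' := tvDist_naturalAttemptWith_le B N S D D' O Tsh ℓ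
  rw [abs_le] at h
  linarith [h.2]

/-! ### The success bound of the model, transferred -/

/-- Event masses of a `PMF` are finite. [folklore] -/
private theorem toOuterMeasure_ne_top'' {γ : Type*} (p : PMF γ) (E : Set γ) : p.toOuterMeasure E ≠ ∞ :=
  ne_top_of_le_ne_top ENNReal.one_ne_top
    (((p.toOuterMeasure_apply_eq_one_iff _).2 (Set.subset_univ _)) ▸ p.toOuterMeasure.mono (Set.subset_univ E))

/-- **MR07 Thm. 5.9, one attempt on `Λ = L(U)` through the model on `B_U = invMatrix Uᵀ`**: for any
oracle kernel `O`, any coordinate sampler law `D`, a width `s` with `2c·η_{2⁻ⁿ}(L(U)) ≤ s` and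
`sβ√n/2 ≤ c r`, the grid `N = N₁|α|td ≥ q`, and `q ≥ 4√m·n√n·β` (`n ≥ 4`): the attempt run with `D`
outputs a good answer of `J` with probability at least
`(δ_{j₀,α} − m(2ε/(1+ε) + n dT/2^ℓ + n q/N))/3 − m·n·Δ(D_{ℤ,Ns,0}, D)`, `ε = 2⁻ⁿ`.
[cite: MicciancioRegev2007, Thm. 5.9 (statement p. 22, proof pp. 22–24)] -/
theorem toReal_naturalAttemptWith_goodAnswers_ge (hJ : J.WellFormed) (hn4 : 4 ≤ J.n) {m q : ℕ} [NeZero q]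
    (O : Matrix (Fin J.n) (Fin m) (ZMod q) → PMF (Fin m → ℤ)) (D : PMF ℤ) (j₀ : Fin m) {α : ℤ} (hα : α ≠ 0)
    {N₁ : ℕ} (hN₁ : 0 < N₁) (hqN : q ≤ NOf J α N₁) {β : ℝ} (hβ : 0 < β)
    (hq : 4 * Real.sqrt m * ((J.n : ℝ) * Real.sqrt J.n) * β ≤ q) {s : ℝ} (hs : 0 < s)
    (hs_lo : 2 * ((cU (Umat J) : ℝ) * smoothingParameter J.lattice ((2⁻¹ : ℝ) ^ J.n)) ≤ s)
    (hs_hi : s * β * Real.sqrt J.n / 2 ≤ cU (Umat J) * J.radius)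
    (hnum : 1 / (2 * π) + (2⁻¹ : ℝ) ^ J.n / (1 - (2⁻¹ : ℝ) ^ J.n) + ((2⁻¹ : ℝ) ^ J.n / (1 - (2⁻¹ : ℝ) ^ J.n)) ^ 2 * m ≤ 1 / 6)
    (ℓ : ℕ) :
    (1 / 3 : ℝ) *
          ((((PMF.uniformOfFintype (Matrix (Fin J.n) (Fin m) (ZMod q))).bind fun A => (O A).map (Prod.mk A)).toOuterMeasure
              {az | az.1.mulVec (fun i => (az.2 i : ZMod q)) = 0 ∧ ∑ i, (az.2 i : ℝ) ^ 2 ≤ β ^ 2 ∧ az.2 j₀ = α}).toReal -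
            m * (2 * (2⁻¹ : ℝ) ^ J.n / (1 + (2⁻¹ : ℝ) ^ J.n) + J.n * (((dT (BU (Umat J)) (Smod J)).toNat : ℝ) / 2 ^ ℓ) +
              J.n * ((q : ℝ) / NOf J α N₁))) -
        m * (J.n * (discreteGaussianInt ((NOf J α N₁ : ℝ) * s) 0).tvDist D) ≤
      ((naturalAttemptWith (BU (Umat J)) (NOf J α N₁) (Smod J) D O (TshOf J m j₀ α N₁) ℓ).toOuterMeasure
        {u | rawE intE (zOf J u) ∈ J.goodAnswers}).toReal := by
  set N := NOf J α N₁ with hNdef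
  set ε : ℝ := (2⁻¹ : ℝ) ^ J.n with hεdef
  have hB := det_BU_ne_zero (det_Umat_ne hJ)
  have hS := Smod_mem hJ
  have hli := Smod_li hJ
  have hNpos : 0 < N := NOf_pos hJ hα hN₁
  haveI : NeZero N := ⟨hNpos.ne'⟩
  haveI : NeZero (Mo (BU (Umat J)) N) := neZero_Mo hB
  haveI : NeZero (MM (BU (Umat J)) N (Smod J)) := neZero_MM hB hS hli
  have hn1 : 1 ≤ J.n := hJ.one_le_n
  have hsqrt : 0 < Real.sqrt J.n := Real.sqrt_pos.2 (by exact_mod_cast hn1)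
  have hc := cR_pos hJ
  -- the radius of the model `r' = sβ√n/2`, so that `2r'/(β√n) = s`
  set r' : ℝ := s * β * Real.sqrt J.n / 2 with hr'
  have hr'pos : 0 < r' := by rw [hr']; positivity
  have hs_eq : 2 * r' / (β * Real.sqrt J.n) = s := by rw [hr']; field_simp
  -- `ε ∈ (0, 1)`
  have hε : 0 < ε := by rw [hεdef]; positivity
  have hε1 : ε < 1 := by rw [hεdef]; exact pow_lt_one₀ (by norm_num) (by norm_num) (by omega)
  -- `2η_ε(Λ') ≤ 2r'/(β√n)`
  have hηs : 2 * smoothingParameter (dualLat (BU (Umat J))) ε ≤ 2 * r' / (β * Real.sqrt J.n) := by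
    rw [hs_eq, smoothingParameter_dualLat_BU_J hJ]; exact hs_lo
  -- the model's bound
  have hmain := toReal_naturalAttempt_success_ge hB hS hli hqN O hε hε1 hβ hr'pos hn1 hηs (norm_Smod_le hJ)
    (TshOf J m j₀ α N₁) ((cU (Umat J) : ℝ) • J.target) j₀ α (fun z hz => sum_smul_fineGridVec_TshOf hJ j₀ hα hN₁ z hz) hnum ℓ
  rw [hs_eq] at hmain
  -- the success event of the model is contained in the good answers
  have hbnd : J.n * Real.sqrt m * β * (cU (Umat J) * J.maxNorm) / q + r' ≤ cU (Umat J) * (J.maxNorm / 8 + J.radius) := by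
    have hq0 : (0 : ℝ) < q := by exact_mod_cast Nat.pos_of_ne_zero (NeZero.ne q)
    have hsn : (2 : ℝ) ≤ Real.sqrt J.n := by
      rw [show (2 : ℝ) = Real.sqrt 4 by rw [show (4 : ℝ) = 2 ^ 2 by norm_num, Real.sqrt_sq (by norm_num)]]
      exact Real.sqrt_le_sqrt (by exact_mod_cast hn4)
    have h8 : 8 * (J.n * Real.sqrt m * β) ≤ q := by
      have hm0 : 0 ≤ Real.sqrt m := Real.sqrt_nonneg _
      have hn0 : (0 : ℝ) ≤ J.n := Nat.cast_nonneg _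
      calc 8 * (J.n * Real.sqrt m * β) = 4 * Real.sqrt m * (J.n * 2) * β := by ring
        _ ≤ 4 * Real.sqrt m * (J.n * Real.sqrt J.n) * β := by gcongr
        _ ≤ q := hq
    have hM := maxNorm_nonneg J
    have hcM : 0 ≤ cU (Umat J) * J.maxNorm := mul_nonneg hc.le hM
    have h1 : J.n * Real.sqrt m * β * (cU (Umat J) * J.maxNorm) / q ≤ cU (Umat J) * (J.maxNorm / 8) := by
      rw [div_le_iff₀ hq0]
      calc J.n * Real.sqrt m * β * (cU (Umat J) * J.maxNorm) = (J.n * Real.sqrt m * β) * (cU (Umat J) * J.maxNorm) := by ring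
        _ ≤ ((q : ℝ) / 8) * (cU (Umat J) * J.maxNorm) := by
            refine mul_le_mul_of_nonneg_right ?_ hcM
            linarith
        _ = cU (Umat J) * (J.maxNorm / 8) * q := by ring
    have h2 : r' ≤ cU (Umat J) * J.radius := hs_hi
    linarith
  have hsub : {u : Fin J.n → ℤ | intVecToEuclidean J.n u ∈ dualLat (BU (Umat J)) ∧
      ‖intVecToEuclidean J.n u - (cU (Umat J) : ℝ) • J.target‖ ≤ J.n * Real.sqrt m * β * (cU (Umat J) * J.maxNorm) / q + r'} ⊆
      {u | rawE intE (zOf J u) ∈ J.goodAnswers} := fun u hu => rawE_zOf_mem_goodAnswers hJ hu.1 hu.2 hbnd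
  have hmono : ((naturalAttempt (BU (Umat J)) N (Smod J) O s (TshOf J m j₀ α N₁) ℓ).toOuterMeasure
      {u : Fin J.n → ℤ | intVecToEuclidean J.n u ∈ dualLat (BU (Umat J)) ∧
        ‖intVecToEuclidean J.n u - (cU (Umat J) : ℝ) • J.target‖ ≤ J.n * Real.sqrt m * β * (cU (Umat J) * J.maxNorm) / q + r'}).toReal ≤
      ((naturalAttempt (BU (Umat J)) N (Smod J) O s (TshOf J m j₀ α N₁) ℓ).toOuterMeasure {u | rawE intE (zOf J u) ∈ J.goodAnswers}).toReal :=
    ENNReal.toReal_mono (toOuterMeasure_ne_top'' _ _) (PMF.toOuterMeasure_mono _ (Set.inter_subset_left.trans hsub))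
  -- change the sampler law
  have htv := toReal_naturalAttemptWith_ge_sub (BU (Umat J)) N (Smod J) (discreteGaussianInt ((N : ℝ) * s) 0) D O
    (TshOf J m j₀ α N₁) ℓ {u | rawE intE (zOf J u) ∈ J.goodAnswers}
  have hnat : naturalAttempt (BU (Umat J)) N (Smod J) O s (TshOf J m j₀ α N₁) ℓ =
      naturalAttemptWith (BU (Umat J)) N (Smod J) (discreteGaussianInt ((N : ℝ) * s) 0) O (TshOf J m j₀ α N₁) ℓ := rfl
  rw [hnat] at hmain hmono
  linarith


variable (J)

/-! ### The parameters -/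

/-- The exponent `e(n) = n + rOf n + 3` of the power of two in the grid. [folklore] -/
def eOf (n : ℕ) : ℕ := n + PGParams.rOf n + 3

/-- `N₂ = q · 2^{e(n)}`. [folklore] -/
def N2Of (q n : ℕ) : ℕ := q * 2 ^ eOf n

/-- **`N₁ = N₂ · rd · βup · n`** (the grid is `N = N₁ |α| td`). [folklore] -/
def N1Of (q βup : ℕ) : ℕ := N2Of q J.n * J.rd * βup * J.n

/-- **`X = c · rn · N₂ · |α| · td = c r N/(βup n)`**, an integer. [folklore] -/
def XOf (q : ℕ) (α : ℤ) : ℕ := (cU (Umat J)).toNat * J.rn * N2Of q J.n * α.natAbs * J.td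

/-- **The mesh exponent `b = ⌊log₂ X⌋`.** [cite: MicciancioRegev2007, Thm. 5.9 (s = 2r/γ, up to a factor 2)] -/
def bOf (q : ℕ) (α : ℤ) : ℕ := Nat.log 2 (XOf J q α)

/-- **The width `s = 2ᵇ√π/N`** of the grid Gaussian (so that `N s = 2ᵇ√π`). [cite: MicciancioRegev2007, Thm. 5.9 (step 2)] -/
def sOf (q βup : ℕ) (α : ℤ) : ℝ := (2 : ℝ) ^ bOf J q α * √π / (NOf J α (N1Of J q βup) : ℝ)

/-- **The box length `ℓ = size dT + size n + n`.** [folklore] -/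
def ellOf : ℕ := Nat.size (dT (BU (Umat J)) (Smod J)).toNat + Nat.size J.n + J.n

variable {J}

/-! ### The grid -/

/-- `N = q · 2^e · rd · βup · n · |α| · td` as a real number. [folklore] -/
theorem cast_NOf_N1Of (q βup : ℕ) (α : ℤ) :
    ((NOf J α (N1Of J q βup) : ℕ) : ℝ) = (q : ℝ) * 2 ^ eOf J.n * J.rd * βup * J.n * |(α : ℝ)| * J.td := by
  rw [NOf, N1Of, N2Of]; push_cast; rw [Nat.cast_natAbs, Int.cast_abs]

/-- `q ≤ N`. [folklore] -/
theorem q_le_NOf (hJ : J.WellFormed) (q : ℕ) {βup : ℕ} (hβup : 1 ≤ βup) {α : ℤ} (hα : α ≠ 0) : q ≤ NOf J α (N1Of J q βup) := by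
  have h1 : 1 ≤ 2 ^ eOf J.n * J.rd * βup * J.n * α.natAbs * J.td := by
    have := hJ.rd_pos; have := hJ.td_pos; have := hJ.one_le_n; have := Int.natAbs_pos.2 hα
    have : 1 ≤ 2 ^ eOf J.n := Nat.one_le_two_pow
    exact Nat.mul_pos (Nat.mul_pos (Nat.mul_pos (Nat.mul_pos (Nat.mul_pos (by omega) (by omega)) (by omega)) (by omega))
      (by omega)) (by omega)
  calc q = q * 1 := (mul_one q).symm
    _ ≤ q * (2 ^ eOf J.n * J.rd * βup * J.n * α.natAbs * J.td) := Nat.mul_le_mul_left q h1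
    _ = NOf J α (N1Of J q βup) := by rw [NOf, N1Of, N2Of]; ring

/-- **The grid slack**: `n · q/N ≤ 2⁻ⁿ`. [cite: MicciancioRegev2007, Thm. 5.9 (eq. (13): the error terms are negligible)] -/
theorem slackN_le (hJ : J.WellFormed) (q : ℕ) {βup : ℕ} (hβup : 1 ≤ βup) {α : ℤ} (hα : α ≠ 0) :
    (J.n : ℝ) * ((q : ℝ) / NOf J α (N1Of J q βup)) ≤ (2⁻¹ : ℝ) ^ J.n := by
  rcases Nat.eq_zero_or_pos q with rfl | hq
  · simp
  have hN := NOf_pos hJ hα (N₁ := N1Of J q βup) (by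
    rw [N1Of, N2Of]; have := hJ.rd_pos; have := hJ.one_le_n
    exact Nat.mul_pos (Nat.mul_pos (Nat.mul_pos (Nat.mul_pos hq Nat.one_le_two_pow) (by omega)) (by omega)) (by omega))
  have hNpos : (0 : ℝ) < (q : ℝ) * 2 ^ eOf J.n * J.rd * βup * J.n * |(α : ℝ)| * J.td := by
    rw [← cast_NOf_N1Of]; exact_mod_cast hN
  rw [cast_NOf_N1Of]
  have hrd : (1 : ℝ) ≤ J.rd := by exact_mod_cast hJ.rd_pos
  have htd : (1 : ℝ) ≤ J.td := by exact_mod_cast hJ.td_pos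
  have hb : (1 : ℝ) ≤ βup := by exact_mod_cast hβup
  have hn : (1 : ℝ) ≤ J.n := by exact_mod_cast hJ.one_le_n
  have ha : (1 : ℝ) ≤ |(α : ℝ)| := by
    rw [← Int.cast_abs]; exact_mod_cast Int.one_le_abs hα
  rw [mul_div_assoc', div_le_iff₀ hNpos]
  -- `n q ≤ 2⁻ⁿ · q 2^e · (rd βup n |α| td)` since `2⁻ⁿ 2^e = 2^{rOf n + 3} ≥ 1`... we only need `n ≤ 2⁻ⁿ 2^e n`
  have he : (2⁻¹ : ℝ) ^ J.n * 2 ^ eOf J.n = 2 ^ (PGParams.rOf J.n + 3) := by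
    rw [eOf, show J.n + PGParams.rOf J.n + 3 = J.n + (PGParams.rOf J.n + 3) by ring, pow_add, ← mul_assoc, ← mul_pow,
      inv_mul_cancel₀ (by norm_num : (2 : ℝ) ≠ 0), one_pow, one_mul]
  have h8 : (1 : ℝ) ≤ 2 ^ (PGParams.rOf J.n + 3) := one_le_pow₀ (by norm_num)
  calc (J.n : ℝ) * q = 1 * (q * 1 * 1 * J.n * 1 * 1) := by ring
    _ ≤ 2 ^ (PGParams.rOf J.n + 3) * (q * J.rd * βup * J.n * |(α : ℝ)| * J.td) := by gcongr
    _ = (2⁻¹ : ℝ) ^ J.n * ((q : ℝ) * 2 ^ eOf J.n * J.rd * βup * J.n * |(α : ℝ)| * J.td) := by rw [← he]; ring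

/-- **The box slack**: `n · dT/2^ℓ ≤ 2⁻ⁿ`. [cite: MicciancioRegev2007, Thm. 5.9 (eq. (13))] -/
theorem slackT_le : (J.n : ℝ) * ((((dT (BU (Umat J)) (Smod J)).toNat : ℕ) : ℝ) / 2 ^ ellOf J) ≤ (2⁻¹ : ℝ) ^ J.n := by
  set d := (dT (BU (Umat J)) (Smod J)).toNat with hd
  have h1 : (d : ℝ) < 2 ^ Nat.size d := by exact_mod_cast Nat.lt_size_self d
  have h2 : (J.n : ℝ) < 2 ^ Nat.size J.n := by exact_mod_cast Nat.lt_size_self J.n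
  have hpos : (0 : ℝ) < 2 ^ ellOf J := by positivity
  rw [mul_div_assoc', div_le_iff₀ hpos, ellOf, pow_add, pow_add]
  have hinv : (2⁻¹ : ℝ) ^ J.n * 2 ^ J.n = 1 := by rw [← mul_pow, inv_mul_cancel₀ (by norm_num : (2 : ℝ) ≠ 0), one_pow]
  have hn0 : (0 : ℝ) ≤ J.n := Nat.cast_nonneg _
  have hd0 : (0 : ℝ) ≤ d := Nat.cast_nonneg _
  calc (J.n : ℝ) * d ≤ 2 ^ Nat.size J.n * 2 ^ Nat.size d := mul_le_mul h2.le h1.le hd0 (by positivity)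
    _ = (2⁻¹ : ℝ) ^ J.n * (2 ^ Nat.size d * 2 ^ Nat.size J.n * 2 ^ J.n) := by
        rw [show (2⁻¹ : ℝ) ^ J.n * (2 ^ Nat.size d * 2 ^ Nat.size J.n * 2 ^ J.n) =
          2 ^ Nat.size J.n * 2 ^ Nat.size d * ((2⁻¹ : ℝ) ^ J.n * 2 ^ J.n) by ring, hinv, mul_one]

/-- **The smoothing slack**: `2ε/(1+ε) ≤ 2ε`. [cite: MicciancioRegev2007, Lemma 5.7 (first claim)] -/
theorem slackE_le (n : ℕ) : 2 * (2⁻¹ : ℝ) ^ n / (1 + (2⁻¹ : ℝ) ^ n) ≤ 2 * (2⁻¹ : ℝ) ^ n := by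
  have hε : (0 : ℝ) ≤ (2⁻¹ : ℝ) ^ n := by positivity
  rw [div_le_iff₀ (by linarith)]
  nlinarith

/-! ### The width -/

/-- `1.7 ≤ √π ≤ 1.8`. [folklore] -/
theorem sqrt_pi_bounds' : (1.7 : ℝ) ≤ √π ∧ √π ≤ 1.8 := by
  constructor
  · rw [Real.le_sqrt (by norm_num) Real.pi_pos.le]
    have := Real.pi_gt_three; nlinarith
  · rw [Real.sqrt_le_left (by norm_num)]
    have := Real.pi_lt_d2; nlinarith

/-- The promise forces `rn ≥ 1` (`r = 0` cannot exceed `g η ≥ 0`). [folklore] -/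
theorem one_le_rn_of_promise {g : ℝ} (hg : 0 ≤ g) (hprom : J.Promise g) : 1 ≤ J.rn := by
  by_contra h
  have h0 : J.rn = 0 := by omega
  have hr : J.radius = 0 := by rw [IncGDDInst.radius, h0]; simp
  have := mul_nonneg hg (smoothingParameter_nonneg J.lattice ((2⁻¹ : ℝ) ^ J.n))
  rw [IncGDDInst.Promise, hr] at hprom
  linarith

/-- `X = c r N/(βup n)` as real numbers. [folklore] -/
theorem cast_XOf (hJ : J.WellFormed) (q : ℕ) {βup : ℕ} (hβup : 1 ≤ βup) (α : ℤ) :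
    ((XOf J q α : ℕ) : ℝ) = cU (Umat J) * J.radius * (NOf J α (N1Of J q βup) : ℝ) / (βup * J.n) := by
  have hc : ((cU (Umat J)).toNat : ℝ) = cU (Umat J) := by
    have := Int.toNat_of_nonneg (cU_pos (det_Umat_ne hJ)).le
    exact_mod_cast this
  have hrd : (J.rd : ℝ) ≠ 0 := by exact_mod_cast hJ.rd_pos.ne'
  have hb : (βup : ℝ) ≠ 0 := by exact_mod_cast (show βup ≠ 0 by omega)
  have hn : (J.n : ℝ) ≠ 0 := by exact_mod_cast (show J.n ≠ 0 by have := hJ.one_le_n; omega)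
  rw [XOf, cast_NOf_N1Of, IncGDDInst.radius, N2Of]
  push_cast
  rw [hc, Nat.cast_natAbs, Int.cast_abs]
  field_simp

/-- `1 ≤ X` on a promise instance (`c, rn, N₂, |α|, td ≥ 1`). [folklore] -/
theorem one_le_XOf (hJ : J.WellFormed) (q : ℕ) {α : ℤ} (hα : α ≠ 0) (hrn : 1 ≤ J.rn) :
    N2Of q J.n ≤ XOf J q α := by
  have hc : 1 ≤ (cU (Umat J)).toNat := by have := cU_pos (det_Umat_ne hJ); omega
  have ha := Int.natAbs_pos.2 hα
  have htd := hJ.td_pos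
  calc N2Of q J.n = 1 * 1 * N2Of q J.n * 1 * 1 := by ring
    _ ≤ (cU (Umat J)).toNat * J.rn * N2Of q J.n * α.natAbs * J.td := by gcongr <;> omega

/-- `2^e ≤ N₂` for `q ≥ 1`. [folklore] -/
theorem two_pow_eOf_le_N2Of {q : ℕ} (hq : 0 < q) (n : ℕ) : 2 ^ eOf n ≤ N2Of q n := by
  rw [N2Of]; exact Nat.le_mul_of_pos_left _ hq

/-- `2ᵇ ≤ X`. [folklore] -/
theorem two_pow_bOf_le {q : ℕ} {α : ℤ} (hX : XOf J q α ≠ 0) : 2 ^ bOf J q α ≤ XOf J q α :=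
  Nat.pow_log_le_self 2 hX

/-- `X < 2^{b+1}`. [folklore] -/
theorem lt_two_pow_bOf_succ (q : ℕ) (α : ℤ) : XOf J q α < 2 ^ (bOf J q α + 1) :=
  Nat.lt_pow_succ_log_self one_lt_two _

/-- **The sampler's precision requirement `n + rOf n + 1 ≤ b`** (indeed `e(n) ≤ b + 1`). [folklore] -/
theorem le_bOf (hJ : J.WellFormed) {q : ℕ} (hq : 0 < q) {α : ℤ} (hα : α ≠ 0) (hrn : 1 ≤ J.rn) :
    J.n + PGParams.rOf J.n + 1 ≤ bOf J q α := by
  have h1 : 2 ^ eOf J.n ≤ XOf J q α := (two_pow_eOf_le_N2Of hq J.n).trans (one_le_XOf hJ q hα hrn)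
  have h2 : XOf J q α < 2 ^ (bOf J q α + 1) := lt_two_pow_bOf_succ q α
  have h3 : eOf J.n < bOf J q α + 1 := (Nat.pow_lt_pow_iff_right (by norm_num)).1 (h1.trans_lt h2)
  rw [eOf] at h3; omega

/-- `N > 0`. [folklore] -/
theorem NOf_N1Of_pos (hJ : J.WellFormed) {q : ℕ} (hq : 0 < q) {βup : ℕ} (hβup : 1 ≤ βup) {α : ℤ} (hα : α ≠ 0) :
    0 < NOf J α (N1Of J q βup) :=
  hq.trans_le (q_le_NOf hJ q hβup hα)

/-- **`N · s = 2ᵇ√π`**, the width of the coin-driven sampler `std n b`. [folklore] -/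
theorem NOf_mul_sOf (hJ : J.WellFormed) {q : ℕ} (hq : 0 < q) {βup : ℕ} (hβup : 1 ≤ βup) {α : ℤ} (hα : α ≠ 0) :
    (NOf J α (N1Of J q βup) : ℝ) * sOf J q βup α = (2 : ℝ) ^ bOf J q α * √π := by
  have hN : ((NOf J α (N1Of J q βup) : ℕ) : ℝ) ≠ 0 := by exact_mod_cast (NOf_N1Of_pos hJ hq hβup hα).ne'
  rw [sOf]
  field_simp

/-- `s > 0`. [folklore] -/
theorem sOf_pos (hJ : J.WellFormed) {q : ℕ} (hq : 0 < q) {βup : ℕ} (hβup : 1 ≤ βup) {α : ℤ} (hα : α ≠ 0) : 0 < sOf J q βup α := by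
  have hN : (0 : ℝ) < ((NOf J α (N1Of J q βup) : ℕ) : ℝ) := by exact_mod_cast NOf_N1Of_pos hJ hq hβup hα
  rw [sOf]; positivity

/-- **`s ≤ √π c r/(βup n)`** (`2ᵇ ≤ X`). [folklore] -/
theorem sOf_le (hJ : J.WellFormed) {q : ℕ} (hq : 0 < q) {βup : ℕ} (hβup : 1 ≤ βup) {α : ℤ} (hα : α ≠ 0) (hrn : 1 ≤ J.rn) :
    sOf J q βup α ≤ √π * (cU (Umat J) * J.radius) / (βup * J.n) := by
  have hN : (0 : ℝ) < ((NOf J α (N1Of J q βup) : ℕ) : ℝ) := by exact_mod_cast NOf_N1Of_pos hJ hq hβup hα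
  have hX0 : XOf J q α ≠ 0 := by
    have := (two_pow_eOf_le_N2Of hq J.n).trans (one_le_XOf hJ q hα hrn)
    have : 0 < 2 ^ eOf J.n := Nat.two_pow_pos _
    omega
  have h2b : ((2 : ℝ) ^ bOf J q α) ≤ (XOf J q α : ℝ) := by exact_mod_cast two_pow_bOf_le hX0
  have hb : (0 : ℝ) < βup := by exact_mod_cast hβup
  have hn : (0 : ℝ) < J.n := by exact_mod_cast hJ.one_le_n
  rw [sOf, div_le_iff₀ hN]
  calc (2 : ℝ) ^ bOf J q α * √π ≤ (XOf J q α : ℝ) * √π := by gcongr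
    _ = √π * (cU (Umat J) * J.radius) / (βup * J.n) * (NOf J α (N1Of J q βup) : ℝ) := by
        rw [cast_XOf hJ q hβup α]; field_simp

/-- **`√π c r/(2 βup n) < s`** (`X < 2^{b+1}`). [folklore] -/
theorem lt_sOf (hJ : J.WellFormed) {q : ℕ} (hq : 0 < q) {βup : ℕ} (hβup : 1 ≤ βup) {α : ℤ} (hα : α ≠ 0) :
    √π * (cU (Umat J) * J.radius) / (2 * (βup * J.n)) < sOf J q βup α := by
  have hN : (0 : ℝ) < ((NOf J α (N1Of J q βup) : ℕ) : ℝ) := by exact_mod_cast NOf_N1Of_pos hJ hq hβup hα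
  have h2b : (XOf J q α : ℝ) < 2 ^ (bOf J q α + 1) := by exact_mod_cast lt_two_pow_bOf_succ (J := J) q α
  have hb : (0 : ℝ) < βup := by exact_mod_cast hβup
  have hn : (0 : ℝ) < J.n := by exact_mod_cast hJ.one_le_n
  have hpi : 0 < √π := Real.sqrt_pos.2 Real.pi_pos
  rw [sOf, lt_div_iff₀ hN]
  rw [pow_succ] at h2b
  calc √π * (cU (Umat J) * J.radius) / (2 * (βup * J.n)) * (NOf J α (N1Of J q βup) : ℝ) = (XOf J q α : ℝ) / 2 * √π := by
        rw [cast_XOf hJ q hβup α]; field_simp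
    _ < 2 ^ bOf J q α * √π := by
        refine mul_lt_mul_of_pos_right ?_ hpi
        linarith

/-- **`hs_hi`: `s β √n/2 ≤ c r`** for `β ≤ βup` (`√π √n ≤ 2n`). [cite: MicciancioRegev2007, Thm. 5.9 (s = 2r/γ, γ ≥ β√n)] -/
theorem sOf_hi (hJ : J.WellFormed) {q : ℕ} (hq : 0 < q) {βup : ℕ} (hβup : 1 ≤ βup) {α : ℤ} (hα : α ≠ 0) (hrn : 1 ≤ J.rn)
    {β : ℝ} (hβ : 0 < β) (hββ : β ≤ βup) : sOf J q βup α * β * Real.sqrt J.n / 2 ≤ cU (Umat J) * J.radius := by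
  have hs := sOf_le hJ hq hβup hα hrn
  have hb : (0 : ℝ) < βup := by exact_mod_cast hβup
  have hn1 : (1 : ℝ) ≤ J.n := by exact_mod_cast hJ.one_le_n
  have hn : (0 : ℝ) < J.n := by linarith
  have hsq : 0 < Real.sqrt J.n := Real.sqrt_pos.2 hn
  have hcr : 0 ≤ cU (Umat J) * J.radius := mul_nonneg (cR_pos hJ).le (by rw [IncGDDInst.radius]; positivity)
  -- `√π √n ≤ 2 n`
  obtain ⟨-, hpi2⟩ := sqrt_pi_bounds'
  have hsn : Real.sqrt J.n ≤ J.n := by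
    rw [Real.sqrt_le_left hn.le]; nlinarith
  have hkey : √π * β * Real.sqrt J.n ≤ 2 * (βup * J.n) := by
    have : √π * Real.sqrt J.n ≤ 2 * J.n := by nlinarith [Real.sqrt_nonneg J.n, Real.sqrt_nonneg π]
    calc √π * β * Real.sqrt J.n = β * (√π * Real.sqrt J.n) := by ring
      _ ≤ βup * (2 * J.n) := mul_le_mul hββ this (by positivity) hb.le
      _ = 2 * (βup * J.n) := by ring
  calc sOf J q βup α * β * Real.sqrt J.n / 2 ≤ (√π * (cU (Umat J) * J.radius) / (βup * J.n)) * β * Real.sqrt J.n / 2 := by gcongr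
    _ = (cU (Umat J) * J.radius) * ((√π * β * Real.sqrt J.n) / (2 * (βup * J.n))) := by field_simp
    _ ≤ (cU (Umat J) * J.radius) * 1 := by
        refine mul_le_mul_of_nonneg_left ?_ hcr
        rw [div_le_one (by positivity)]; exact hkey
    _ = cU (Umat J) * J.radius := mul_one _

/-- **`hs_lo` from the promise**: if `r > 3 βup n · η_{2⁻ⁿ}(L(U))` then `2c·η_{2⁻ⁿ}(L(U)) ≤ s`
(`4/√π < 3`). [cite: MicciancioRegev2007, Thm. 5.9 (r > γ(n) φ(B) gives s ≥ 2η)] -/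
theorem sOf_lo (hJ : J.WellFormed) {q : ℕ} (hq : 0 < q) {βup : ℕ} (hβup : 1 ≤ βup) {α : ℤ} (hα : α ≠ 0)
    (hprom : J.Promise (3 * (βup : ℝ) * J.n)) :
    2 * ((cU (Umat J) : ℝ) * smoothingParameter J.lattice ((2⁻¹ : ℝ) ^ J.n)) ≤ sOf J q βup α := by
  have hlt := lt_sOf hJ hq hβup hα
  have hb : (0 : ℝ) < βup := by exact_mod_cast hβup
  have hn : (0 : ℝ) < J.n := by exact_mod_cast hJ.one_le_n
  have hc := cR_pos hJ
  have hη := smoothingParameter_nonneg J.lattice ((2⁻¹ : ℝ) ^ J.n)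
  obtain ⟨hpi1, -⟩ := sqrt_pi_bounds'
  rw [IncGDDInst.Promise] at hprom
  -- `2 c η ≤ √π c r/(2 βup n)` since `r ≥ 3 βup n η` and `√π · 3/2 ≥ 2`
  refine le_trans ?_ hlt.le
  rw [le_div_iff₀ (by positivity)]
  have h1 : (cU (Umat J) : ℝ) * (3 * βup * J.n * smoothingParameter J.lattice ((2⁻¹ : ℝ) ^ J.n)) ≤ cU (Umat J) * J.radius :=
    mul_le_mul_of_nonneg_left hprom.le hc.le
  nlinarith [mul_nonneg hc.le hη, mul_nonneg (mul_nonneg hc.le hη) (mul_nonneg hb.le hn.le)]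

/-! ### One attempt of the machine's shape on a promise instance -/

/-- **MR07 Thm. 5.9 for one attempt as the machine runs it** (fixed guess `(j₀, α)`, a coordinate sampler
law `D` within `τ` of the exact `D_{ℤ, N s, 0}`, any oracle kernel `O`): on a well-formed instance of
dimension `n ≥ 4` satisfying the promise `r > 3 βup n · η_{2⁻ⁿ}(L(U))`, with `β ≤ βup` and
`q ≥ 4√m n√n β`, the attempt outputs a good answer with probability at least
`(δ_{j₀,α} − 4m·2⁻ⁿ)/3 − m n τ`. [cite: MicciancioRegev2007, Thm. 5.9 (statement p. 22, proof pp. 22–24)] -/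
theorem toReal_attempt_goodAnswers_ge_of_promise (hJ : J.WellFormed) (hn4 : 4 ≤ J.n) {m q : ℕ} [NeZero q]
    (O : Matrix (Fin J.n) (Fin m) (ZMod q) → PMF (Fin m → ℤ)) (D : PMF ℤ) (j₀ : Fin m) {α : ℤ} (hα : α ≠ 0)
    {βup : ℕ} (hβup : 1 ≤ βup) {β : ℝ} (hβ : 0 < β) (hββ : β ≤ βup)
    (hq : 4 * Real.sqrt m * ((J.n : ℝ) * Real.sqrt J.n) * β ≤ q) (hprom : J.Promise (3 * (βup : ℝ) * J.n))
    (hnum : 1 / (2 * π) + (2⁻¹ : ℝ) ^ J.n / (1 - (2⁻¹ : ℝ) ^ J.n) + ((2⁻¹ : ℝ) ^ J.n / (1 - (2⁻¹ : ℝ) ^ J.n)) ^ 2 * m ≤ 1 / 6)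
    {τ : ℝ} (hD : (discreteGaussianInt ((NOf J α (N1Of J q βup) : ℝ) * sOf J q βup α) 0).tvDist D ≤ τ) :
    (1 / 3 : ℝ) *
          ((((PMF.uniformOfFintype (Matrix (Fin J.n) (Fin m) (ZMod q))).bind fun A => (O A).map (Prod.mk A)).toOuterMeasure
              {az | az.1.mulVec (fun i => (az.2 i : ZMod q)) = 0 ∧ ∑ i, (az.2 i : ℝ) ^ 2 ≤ β ^ 2 ∧ az.2 j₀ = α}).toReal -
            m * (4 * (2⁻¹ : ℝ) ^ J.n)) -
        m * (J.n * τ) ≤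
      ((naturalAttemptWith (BU (Umat J)) (NOf J α (N1Of J q βup)) (Smod J) D O
          (TshOf J m j₀ α (N1Of J q βup)) (ellOf J)).toOuterMeasure {u | rawE intE (zOf J u) ∈ J.goodAnswers}).toReal := by
  have hq0 : 0 < q := Nat.pos_of_ne_zero (NeZero.ne q)
  have hrn : 1 ≤ J.rn := one_le_rn_of_promise (by positivity) hprom
  have hN1 : 0 < N1Of J q βup := by
    rw [N1Of, N2Of]; have := hJ.rd_pos; have := hJ.one_le_n
    exact Nat.mul_pos (Nat.mul_pos (Nat.mul_pos (Nat.mul_pos hq0 Nat.one_le_two_pow) (by omega)) (by omega)) (by omega)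
  have hmain := toReal_naturalAttemptWith_goodAnswers_ge hJ hn4 O D j₀ hα hN1
    (q_le_NOf hJ q hβup hα) hβ hq (sOf_pos hJ hq0 hβup hα) (sOf_lo hJ hq0 hβup hα hprom) (sOf_hi hJ hq0 hβup hα hrn hβ hββ) hnum (ellOf J)
  -- the slack terms
  have hε : (0 : ℝ) ≤ (2⁻¹ : ℝ) ^ J.n := by positivity
  have hm0 : (0 : ℝ) ≤ m := Nat.cast_nonneg _
  have hn0 : (0 : ℝ) ≤ J.n := Nat.cast_nonneg _
  have hslack : (m : ℝ) * (2 * (2⁻¹ : ℝ) ^ J.n / (1 + (2⁻¹ : ℝ) ^ J.n) +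
      J.n * ((((dT (BU (Umat J)) (Smod J)).toNat : ℕ) : ℝ) / 2 ^ ellOf J) + J.n * ((q : ℝ) / NOf J α (N1Of J q βup))) ≤
      m * (4 * (2⁻¹ : ℝ) ^ J.n) := by
    refine mul_le_mul_of_nonneg_left ?_ hm0
    have h1 := slackE_le J.n
    have h2 := slackT_le (J := J)
    have h3 := slackN_le hJ q hβup hα
    linarith
  -- the sampler
  have hsamp : (m : ℝ) * (J.n * (discreteGaussianInt ((NOf J α (N1Of J q βup) : ℝ) * sOf J q βup α) 0).tvDist D) ≤
      m * (J.n * τ) :=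
    mul_le_mul_of_nonneg_left (mul_le_mul_of_nonneg_left hD hn0) hm0
  linarith


/-! ### Paired experiments: comparing two kernels event by event -/

/-- The mass of a paired experiment `a ∼ μ, z ∼ O a` as a finite sum over `a`. [folklore] -/
theorem toReal_bind_pair_eq_sum {α β : Type*} [Fintype α] (μ : PMF α) (O : α → PMF β) (H : Set (α × β)) :
    ((μ.bind fun a => (O a).map (Prod.mk a)).toOuterMeasure H).toReal =
      ∑ a, (μ a).toReal * ((O a).toOuterMeasure (Prod.mk a ⁻¹' H)).toReal := by
  rw [PMF.toReal_toOuterMeasure_bind_apply, tsum_fintype]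
  refine Finset.sum_congr rfl fun a _ => ?_
  rw [PMF.toOuterMeasure_map_apply]

/-- **Kernel domination, event form**: if every event has `θ · (O a)(E) ≤ (O' a)(E)`, then
`θ · Pr_{a ∼ μ, z ∼ O a}[H] ≤ Pr_{a ∼ μ, z ∼ O' a}[H]`. [folklore] -/
theorem mul_toReal_bind_pair_le {α β : Type*} [Fintype α] (μ : PMF α) {O O' : α → PMF β} {θ : ℝ}
    (h : ∀ a (E : Set β), θ * ((O a).toOuterMeasure E).toReal ≤ ((O' a).toOuterMeasure E).toReal) (H : Set (α × β)) :
    θ * ((μ.bind fun a => (O a).map (Prod.mk a)).toOuterMeasure H).toReal ≤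
      ((μ.bind fun a => (O' a).map (Prod.mk a)).toOuterMeasure H).toReal := by
  rw [toReal_bind_pair_eq_sum, toReal_bind_pair_eq_sum, Finset.mul_sum]
  refine Finset.sum_le_sum fun a _ => ?_
  rw [mul_left_comm]
  exact mul_le_mul_of_nonneg_left (h a _) ENNReal.toReal_nonneg

/-! ### The oracle kernel of the machine's call and the guess -/

/-- **The oracle kernel realised by a string kernel `K`** (the law of the answer string of the call on
`A`), read as an integer vector of dimension `m`. [cite: MicciancioRegev2007, Thm. 5.9 (step 3)] -/
def decKernel {n m q : ℕ} (K : Matrix (Fin n) (Fin m) (ZMod q) → PMF (List Bool)) (A : Matrix (Fin n) (Fin m) (ZMod q)) :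
    PMF (Fin m → ℤ) :=
  (K A).map (decodeIntVec m)

/-- **The guess index** `i = j₀ · (2β̂) + a` handed to the attempt. [cite: MicciancioRegev2007, Thm. 5.9 (step 1)] -/
def guessIdx (βhat j₀ a : ℕ) : ℕ := j₀ * (2 * βhat) + a

/-- A positive `SIS′` advantage forces `β ≥ 1` and `m ≥ 1` (a solution has an odd, hence nonzero,
coordinate, so `‖z‖ ≥ 1`). [cite: MicciancioRegev2007, Def. 5.4] -/
theorem one_le_beta_of_successProb'_pos (B : RandAlg (List Bool) (List Bool)) {n m q : ℕ} [NeZero q] {β : ℝ}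
    (h : 0 < successProb' B n m q β) : 1 ≤ β ∧ 0 < m := by
  by_contra hcon
  have hempty : ∀ (A : Matrix (Fin n) (Fin m) (ZMod q)) (z : Fin m → ℤ), ¬ IsSolution' A β z := by
    intro A z hz
    obtain ⟨⟨j, hj⟩, -, hnorm⟩ := hz
    have hm : 0 < m := Fin.pos j
    have hz0 : z j ≠ 0 := fun h0 => by rw [h0] at hj; exact (Int.not_even_iff_odd.2 hj) ⟨0, rfl⟩
    have h1 : (1 : ℝ) ≤ |(z j : ℝ)| := by
      rw [← Int.cast_abs]; exact_mod_cast Int.one_le_abs hz0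
    have h2 := abs_cast_le_norm_intVecToEuclidean z j
    exact hcon ⟨by linarith, hm⟩
  have hzero : successProb' B n m q β = 0 := by
    rw [successProb']
    have : (fun A : Matrix (Fin n) (Fin m) (ZMod q) => B.pr id (encodeMatrix A) {w | IsSolution' A β (decodeIntVec m w)}) = fun _ => 0 := by
      funext A
      have hset : {w | IsSolution' A β (decodeIntVec m w)} = ∅ := Set.eq_empty_of_forall_notMem fun w hw => hempty A _ hw
      rw [hset, RandAlg.pr]
      simp
    rw [this, matrixAvg]
    simp
  linarith

/-- **The guess, transported to the machine's kernel.** If `δ ≤ successProb'(B)` with `δ > 0` and the string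
kernel `K` dominates `θ` times the law of `B` on every query, event by event (`θ ≥ 0`), then for some
position `j₀` and some nonzero `α`, `|α| ≤ ⌊β⌋`, the event of the fine-grid analysis under `decKernel K`
has mass `≥ θ · δ/(2βm)`. [cite: MicciancioRegev2007, Thm. 5.9 (proof, p. 23: "δ_{j′,α′} ≥ δ/2βm")] -/
theorem exists_guess_kernelEvent (B : RandAlg (List Bool) (List Bool)) {n m q : ℕ} [NeZero q] {β δ θ : ℝ} (hδ : 0 < δ)
    (hδB : δ ≤ successProb' B n m q β) (hθ : 0 ≤ θ) (K : Matrix (Fin n) (Fin m) (ZMod q) → PMF (List Bool))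
    (hK : ∀ (A : Matrix (Fin n) (Fin m) (ZMod q)) (E : Set (List Bool)), θ * B.pr id (encodeMatrix A) E ≤ ((K A).toOuterMeasure E).toReal) :
    ∃ j₀ : Fin m, ∃ α : ℤ, α ≠ 0 ∧ |α| ≤ ⌊β⌋₊ ∧
      θ * (δ / (2 * β * m)) ≤
        ((((PMF.uniformOfFintype (Matrix (Fin n) (Fin m) (ZMod q))).bind fun A => (decKernel K A).map (Prod.mk A)).toOuterMeasure
            {az | az.1.mulVec (fun i => (az.2 i : ZMod q)) = 0 ∧ ∑ i, (az.2 i : ℝ) ^ 2 ≤ β ^ 2 ∧ az.2 j₀ = α}).toReal) := by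
  obtain ⟨hβ1, hm⟩ := one_le_beta_of_successProb'_pos B (hδ.trans_le hδB)
  have hβ0 : 0 ≤ β := by linarith
  -- the printed guessing step
  obtain ⟨j₀, α, hα0, hαβ, hguess⟩ := exists_guess B n m q hβ1 hm (fun A => {w | IsSolution' A β (decodeIntVec m w)})
    (fun A w hw => ⟨hw.isSolution.1, hw.2.2⟩)
  refine ⟨j₀, α, hα0, ?_, ?_⟩
  · have h1 : |α| ≤ ⌊β⌋ := Int.le_floor.2 (by push_cast; exact hαβ)
    rwa [← Int.natCast_floor_eq_floor hβ0] at h1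
  -- the true kernel's event mass
  set O : Matrix (Fin n) (Fin m) (ZMod q) → PMF (Fin m → ℤ) := fun A => (B.outputPMF id (encodeMatrix A)).map (decodeIntVec m) with hO
  set H : Set (Matrix (Fin n) (Fin m) (ZMod q) × (Fin m → ℤ)) :=
    {az | az.1.mulVec (fun i => (az.2 i : ZMod q)) = 0 ∧ ∑ i, (az.2 i : ℝ) ^ 2 ≤ β ^ 2 ∧ az.2 j₀ = α} with hH
  have hsucc : successProb' B n m q β = matrixAvg n m q fun A => B.pr id (encodeMatrix A) {w | IsSolution' A β (decodeIntVec m w)} := rfl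
  have havg : matrixAvg n m q (fun A => B.pr id (encodeMatrix A) ({w | IsSolution' A β (decodeIntVec m w)} ∩ {w | decodeIntVec m w j₀ = α})) ≤
      (((PMF.uniformOfFintype (Matrix (Fin n) (Fin m) (ZMod q))).bind fun A => (O A).map (Prod.mk A)).toOuterMeasure H).toReal := by
    have heq := matrixAvg_pr_eq_toReal_bind (n := n) (q := q) B (fun A => {z : Fin m → ℤ | IsSolution' A β z ∧ z j₀ = α})
    have hsets : (fun A : Matrix (Fin n) (Fin m) (ZMod q) => B.pr id (encodeMatrix A)
        ({w | IsSolution' A β (decodeIntVec m w)} ∩ {w | decodeIntVec m w j₀ = α})) =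
        fun A => B.pr id (encodeMatrix A) {w | decodeIntVec m w ∈ {z : Fin m → ℤ | IsSolution' A β z ∧ z j₀ = α}} := by
      funext A; rfl
    rw [hsets, heq]
    refine ENNReal.toReal_mono (PMF.toOuterMeasure_ne_top _ _) (PMF.toOuterMeasure_mono _ (Set.inter_subset_left.trans ?_))
    rintro ⟨A, z⟩ ⟨hsol, hz⟩
    exact mulVec_eq_zero_and_of_isSolution hsol.isSolution hz
  -- the machine's kernel dominates `θ` times the true kernel, event by event
  have hdom : ∀ (A : Matrix (Fin n) (Fin m) (ZMod q)) (E : Set (Fin m → ℤ)),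
      θ * ((O A).toOuterMeasure E).toReal ≤ ((decKernel K A).toOuterMeasure E).toReal := by
    intro A E
    rw [hO, decKernel, PMF.toOuterMeasure_map_apply, PMF.toOuterMeasure_map_apply]
    exact hK A _
  have hcall := mul_toReal_bind_pair_le (PMF.uniformOfFintype (Matrix (Fin n) (Fin m) (ZMod q))) hdom H
  calc θ * (δ / (2 * β * m)) ≤ θ * (successProb' B n m q β / (2 * β * m)) := by
        gcongr
    _ ≤ θ * (((PMF.uniformOfFintype (Matrix (Fin n) (Fin m) (ZMod q))).bind fun A => (O A).map (Prod.mk A)).toOuterMeasure H).toReal :=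
        mul_le_mul_of_nonneg_left (hsucc ▸ hguess.trans havg) hθ
    _ ≤ _ := hcall

/-! ### The numerical side condition -/

/-- `1/(2π) < 0.1593`. [folklore] -/
theorem inv_two_pi_lt : 1 / (2 * π) < (0.1593 : ℝ) := by
  have hpi := Real.pi_gt_d2
  rw [div_lt_iff₀ (by positivity)]
  nlinarith

/-- **The side condition of the conditional `2/3` bound** holds for `ε = 2⁻ⁿ` once `n ≥ 9` and `4m ≤ 2ⁿ`:
`1/(2π) + ε/(1−ε) + (ε/(1−ε))² m ≤ 1/6`. [cite: MicciancioRegev2007, Thm. 5.9 (proof, p. 24: the constant 1/(2π) + o(1) < 1/6)] -/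
theorem hnum_of_le {n m : ℕ} (hn : 9 ≤ n) (hm : 4 * (m : ℝ) ≤ 2 ^ n) :
    1 / (2 * π) + (2⁻¹ : ℝ) ^ n / (1 - (2⁻¹ : ℝ) ^ n) + ((2⁻¹ : ℝ) ^ n / (1 - (2⁻¹ : ℝ) ^ n)) ^ 2 * m ≤ 1 / 6 := by
  set ε : ℝ := (2⁻¹ : ℝ) ^ n with hε
  have hε0 : 0 < ε := by rw [hε]; positivity
  have h2n : (2 : ℝ) ^ n * ε = 1 := by rw [hε, ← mul_pow, mul_inv_cancel₀ (by norm_num : (2 : ℝ) ≠ 0), one_pow]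
  have h512 : (512 : ℝ) ≤ 2 ^ n := by
    calc (512 : ℝ) = 2 ^ 9 := by norm_num
      _ ≤ 2 ^ n := pow_le_pow_right₀ (by norm_num) hn
  have hεs : ε ≤ 1 / 512 := by
    rw [le_div_iff₀ (by norm_num)]; nlinarith
  have hm0 : (0 : ℝ) ≤ m := Nat.cast_nonneg m
  have hεm : 4 * ε * m ≤ 1 := by
    have := mul_le_mul_of_nonneg_left hm hε0.le
    nlinarith
  -- `ε/(1-ε) ≤ 2ε`, and the square term `≤ 4ε² m ≤ ε`
  have h1ε : 1 / 2 ≤ 1 - ε := by linarith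
  have hq : ε / (1 - ε) ≤ 2 * ε := by
    rw [div_le_iff₀ (by linarith)]; nlinarith
  have hq0 : 0 ≤ ε / (1 - ε) := div_nonneg hε0.le (by linarith)
  have hsq : (ε / (1 - ε)) ^ 2 * m ≤ ε := by
    calc (ε / (1 - ε)) ^ 2 * m ≤ (2 * ε) ^ 2 * m := by gcongr
      _ = ε * (4 * ε * m) := by ring
      _ ≤ ε * 1 := mul_le_mul_of_nonneg_left hεm hε0.le
      _ = ε := mul_one ε
  have hpi := inv_two_pi_lt
  linarith

/-! ### Polynomial bookkeeping -/

/-- Pointwise domination preserves polynomial boundedness. [folklore] -/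
private theorem isPolyBounded_of_le' {f g : ℕ → ℕ} (hg : IsPolyBounded g) (h : ∀ n, f n ≤ g n) : IsPolyBounded f := by
  obtain ⟨p, hp⟩ := hg; exact ⟨p, fun n => (h n).trans (hp n)⟩

/-- Products of polynomially bounded functions. [folklore] -/
private theorem isPolyBounded_mul' {f g : ℕ → ℕ} (hf : IsPolyBounded f) (hg : IsPolyBounded g) : IsPolyBounded fun n => f n * g n := by
  obtain ⟨p, hp⟩ := hf; obtain ⟨q, hq⟩ := hg
  exact ⟨p * q, fun n => by rw [eval_mul]; exact Nat.mul_le_mul (hp n) (hq n)⟩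

/-- `⌊β⌋₊ + 1` is polynomially bounded when `β` is. [folklore] -/
theorem isPolyBounded_floor_succ {β : ℕ → ℝ} (hβ : IsPolyBoundedReal β) : IsPolyBounded fun n => ⌊β n⌋₊ + 1 := by
  obtain ⟨p, hp⟩ := hβ
  refine ⟨p + 1, fun n => ?_⟩
  rw [eval_add, eval_one]
  have : ⌊β n⌋₊ ≤ p.eval n := Nat.floor_le_of_le (hp n)
  show ⌊β n⌋₊ + 1 ≤ p.eval n + 1
  omega

/-! ### The success clause of `H59a` from the law of an attempt machine -/

/-- **MR07 Thm. 5.9 at machine level, the success bound.** Let `B` be a PPT `SIS′` solver with advantage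
`≥ 1/n^c` on `S`, `β̂ = ⌊β⌋`, and let `Att p` be a family of machines, indexed by a precision polynomial `p`,
whose output law on `⟨J, ⟨1ⁱ, w⟩⟩`, `i = j₀·2β̂(n) + a'`, is the fine-grid attempt on `B_U` with the
machine's parameters, a coordinate sampler law `D p J α` within `20/(p(n)+1)` of `D_{ℤ, N s, 0}` for `n`
large (`hD`) and the oracle kernel of a string kernel `K n` that dominates `2^{-W(n)}` times the law of `B`
event by event (`hK`, `2^{W}` polynomially bounded), read through `zOf` (`hlaw`). Then with
`g(n) = 3 (β̂(n)+1) n` there are `p`, `G`, `e`, `n₀` such that every well-formed instance of dimension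
`n ∈ S`, `n ≥ n₀`, satisfying the promise `r > g(n) η_{2⁻ⁿ}(L(U))` is answered well by `Att p` with
probability `≥ 1/n^e` for some guess `i < G(n)`, whatever the pad `w`.
[cite: MicciancioRegev2007, Thm. 5.9 (statement p. 22, proof pp. 22–24)] -/
theorem attempt_success_of_law (q m : ℕ → ℕ) [∀ n, NeZero (q n)] (β : ℕ → ℝ)
    (hm : IsPolyBounded m) (hβ : IsPolyBoundedReal β) (hmod : MRModulusCondition q m β)
    (B : RandAlg (List Bool) (List Bool)) (c : ℕ) (S : Set ℕ)
    (hS : ∀ n ∈ S, 1 / (n : ℝ) ^ c ≤ SIS.successProb' B n (m n) (q n) (β n))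
    (W : ℕ → ℕ) (hWpoly : IsPolyBounded fun n => 2 ^ W n)
    (K : (n : ℕ) → Matrix (Fin n) (Fin (m n)) (ZMod (q n)) → PMF (List Bool))
    (hK : ∀ n (A : Matrix (Fin n) (Fin (m n)) (ZMod (q n))) (E : Set (List Bool)),
      (2⁻¹ : ℝ) ^ W n * B.pr id (encodeMatrix A) E ≤ ((K n A).toOuterMeasure E).toReal)
    (D : Polynomial ℕ → IncGDDInst → ℤ → PMF ℤ)
    (hD : ∀ p : Polynomial ℕ, ∃ n₁ : ℕ, ∀ J : IncGDDInst, J.WellFormed → n₁ ≤ J.n → ∀ α : ℤ, α ≠ 0 → 1 ≤ J.rn →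
      (discreteGaussianInt ((NOf J α (N1Of J (q J.n) (⌊β J.n⌋₊ + 1)) : ℝ) * sOf J (q J.n) (⌊β J.n⌋₊ + 1) α) 0).tvDist (D p J α) ≤
        20 / (((p.eval J.n : ℕ) : ℝ) + 1))
    (Att : Polynomial ℕ → RandAlg (List Bool) (List Bool))
    (hlaw : ∀ (p : Polynomial ℕ) (J : IncGDDInst), J.WellFormed → 4 ≤ J.n → ∀ (j₀ : Fin (m J.n)) (a' : Fin (2 * ⌊β J.n⌋₊)) (w : List Bool),
      (Att p).outputPMF id (boolPair J.encode (boolPair (unE (guessIdx ⌊β J.n⌋₊ j₀ a')) w)) =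
        (naturalAttemptWith (BU (Umat J)) (NOf J (alphaOf ⌊β J.n⌋₊ a') (N1Of J (q J.n) (⌊β J.n⌋₊ + 1))) (Smod J)
            (D p J (alphaOf ⌊β J.n⌋₊ a')) (decKernel (K J.n))
            (TshOf J (m J.n) j₀ (alphaOf ⌊β J.n⌋₊ a') (N1Of J (q J.n) (⌊β J.n⌋₊ + 1))) (ellOf J)).map
          fun u => rawE intE (zOf J u)) :
    ∃ p : Polynomial ℕ, ∃ G : Polynomial ℕ, ∃ (e n₀ : ℕ), ∀ J : IncGDDInst, J.WellFormed → J.n ∈ S → n₀ ≤ J.n →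
      J.Promise (3 * ((⌊β J.n⌋₊ + 1 : ℕ) : ℝ) * J.n) →
        ∃ i < G.eval J.n, ∀ w : List Bool,
          1 / (J.n : ℝ) ^ e ≤ (Att p).pr id (boolPair J.encode (boolPair (unE i) w)) J.goodAnswers := by
  -- the polynomial `G` bounding the guess indices
  obtain ⟨pm, hpm⟩ := hm
  obtain ⟨pG, hpG⟩ : IsPolyBounded fun n => m n * (2 * (⌊β n⌋₊ + 1)) :=
    isPolyBounded_mul' ⟨pm, hpm⟩ (isPolyBounded_mul' ⟨Polynomial.C 2, fun n => by simp⟩ (isPolyBounded_floor_succ hβ))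
  -- the polynomial loss `D(n) = 2^{W} · 2β̂⁺ m · n^c` and its eventual power bound
  have hDpoly : IsPolyBounded fun n => 2 ^ W n * (2 * (⌊β n⌋₊ + 1) * m n) * n ^ c :=
    isPolyBounded_mul' (isPolyBounded_mul' hWpoly (isPolyBounded_mul' (isPolyBounded_mul' ⟨Polynomial.C 2, fun n => by simp⟩
      (isPolyBounded_floor_succ hβ)) ⟨pm, hpm⟩)) ⟨X ^ c, fun n => by simp⟩
  obtain ⟨d, hd⟩ := IsPolyBounded.eventually_le_pow hDpoly
  obtain ⟨dm, hdm⟩ := IsPolyBounded.eventually_le_pow (f := m) ⟨pm, hpm⟩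
  -- the precision of the sampler: `p₀ = 240 X^{d+dm+2}`
  set p₀ : Polynomial ℕ := Polynomial.C 240 * X ^ (d + dm + 2) with hp₀
  obtain ⟨n₁, hn₁⟩ := hD p₀
  -- large `n`: the exponential slack is below the polynomial losses
  have h2pow := eventually_mul_pow_le_two_pow (d + dm + 2) 480
  obtain ⟨n₀, hn₀⟩ := Filter.eventually_atTop.1 ((hd.and hdm).and (h2pow.and ((eventually_ge_atTop 9).and (eventually_ge_atTop n₁))))
  refine ⟨p₀, pG, d + 4, n₀, fun J hJ hnS hn0 hprom => ?_⟩
  obtain ⟨⟨hdn, hdmn⟩, h2n, hn9, hn1'⟩ := hn₀ J.n hn0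
  have hn4 : 4 ≤ J.n := by omega
  have hn1 : (1 : ℝ) ≤ J.n := by exact_mod_cast (show 1 ≤ J.n by omega)
  have hnpos : (0 : ℝ) < J.n := by linarith
  -- the advantage at `n`
  have hδ : 0 < 1 / (J.n : ℝ) ^ c := by positivity
  have hadv := hS J.n hnS
  obtain ⟨hβ1, hmpos⟩ := one_le_beta_of_successProb'_pos B (hδ.trans_le hadv)
  have hβpos : 0 < β J.n := by linarith
  -- the guess
  obtain ⟨j₀, α, hα0, hαβ, hevent⟩ := exists_guess_kernelEvent B hδ hadv (by positivity) (K J.n) (hK J.n)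
  obtain ⟨a', ha'⟩ := exists_alphaOf_eq (βhat := ⌊β J.n⌋₊) hα0 hαβ
  refine ⟨guessIdx ⌊β J.n⌋₊ j₀ a', ?_, fun w => ?_⟩
  · -- `i < G(n)`
    have hj := j₀.isLt
    have ha := a'.isLt
    calc guessIdx ⌊β J.n⌋₊ j₀ a' < m J.n * (2 * ⌊β J.n⌋₊) := by
          unfold guessIdx
          calc (j₀ : ℕ) * (2 * ⌊β J.n⌋₊) + a' < (j₀ : ℕ) * (2 * ⌊β J.n⌋₊) + 2 * ⌊β J.n⌋₊ := by omega
            _ = ((j₀ : ℕ) + 1) * (2 * ⌊β J.n⌋₊) := by ring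
            _ ≤ m J.n * (2 * ⌊β J.n⌋₊) := Nat.mul_le_mul_right _ hj
      _ ≤ m J.n * (2 * (⌊β J.n⌋₊ + 1)) := Nat.mul_le_mul_left _ (by omega)
      _ ≤ pG.eval J.n := hpG J.n
  -- the probability of a good answer is the model's
  have hpr : (Att p₀).pr id (boolPair J.encode (boolPair (unE (guessIdx ⌊β J.n⌋₊ j₀ a')) w)) J.goodAnswers =
      ((naturalAttemptWith (BU (Umat J)) (NOf J α (N1Of J (q J.n) (⌊β J.n⌋₊ + 1))) (Smod J)
          (D p₀ J α) (decKernel (K J.n))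
          (TshOf J (m J.n) j₀ α (N1Of J (q J.n) (⌊β J.n⌋₊ + 1))) (ellOf J)).toOuterMeasure {u | rawE intE (zOf J u) ∈ J.goodAnswers}).toReal := by
    rw [RandAlg.pr, hlaw p₀ J hJ hn4 j₀ a' w, ha', PMF.toOuterMeasure_map_apply]
    rfl
  rw [hpr]
  -- the model's bound on the promise instance
  have hβup1 : 1 ≤ ⌊β J.n⌋₊ + 1 := by omega
  have hββ : β J.n ≤ ((⌊β J.n⌋₊ + 1 : ℕ) : ℝ) := by push_cast; exact (Nat.lt_floor_add_one (β J.n)).le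
  have hqn : 4 * Real.sqrt (m J.n) * ((J.n : ℝ) * Real.sqrt J.n) * β J.n ≤ q J.n := hmod J.n
  have hm4 : 4 * (m J.n : ℝ) ≤ 2 ^ J.n := by
    have h1 : (m J.n : ℝ) ≤ (J.n : ℝ) ^ dm := by exact_mod_cast hdmn
    have h3 : (J.n : ℝ) ^ dm ≤ (J.n : ℝ) ^ (d + dm + 2) := pow_le_pow_right₀ hn1 (by omega)
    nlinarith
  have hnum := hnum_of_le hn9 hm4
  have hrn : 1 ≤ J.rn := one_le_rn_of_promise (by positivity) hprom
  have hmain := toReal_attempt_goodAnswers_ge_of_promise hJ hn4 (decKernel (K J.n)) (D p₀ J α) j₀ hα0 hβup1 hβpos hββ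
    hqn hprom hnum (hn₁ J hJ hn1' α hα0 hrn)
  -- absorb the losses: `δ₁ = 2^{-W} δ/(2βm) ≥ 1/D(n) ≥ 1/n^d`
  set δ₁ : ℝ := (2⁻¹ : ℝ) ^ W J.n * (1 / (J.n : ℝ) ^ c / (2 * β J.n * m J.n)) with hδ₁
  have hDn : (2 : ℝ) ^ W J.n * (2 * ((⌊β J.n⌋₊ + 1 : ℕ) : ℝ) * m J.n) * (J.n : ℝ) ^ c ≤ (J.n : ℝ) ^ d := by exact_mod_cast hdn
  have hmn1 : (1 : ℝ) ≤ m J.n := by exact_mod_cast hmpos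
  have hδ₁ge : 1 / (J.n : ℝ) ^ d ≤ δ₁ := by
    rw [hδ₁]
    have hpos : (0 : ℝ) < 2 ^ W J.n * (2 * β J.n * m J.n) * (J.n : ℝ) ^ c := by positivity
    have hle : (2 : ℝ) ^ W J.n * (2 * β J.n * m J.n) * (J.n : ℝ) ^ c ≤ (J.n : ℝ) ^ d := by
      refine le_trans ?_ hDn
      gcongr
    rw [show (2⁻¹ : ℝ) ^ W J.n * (1 / (J.n : ℝ) ^ c / (2 * β J.n * m J.n)) = 1 / (2 ^ W J.n * (2 * β J.n * m J.n) * (J.n : ℝ) ^ c) by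
      rw [inv_pow]; field_simp]
    exact one_div_le_one_div_of_le hpos hle
  -- the exponential slack
  have hε : (2⁻¹ : ℝ) ^ J.n * 2 ^ J.n = 1 := by rw [← mul_pow, inv_mul_cancel₀ (by norm_num : (2 : ℝ) ≠ 0), one_pow]
  have hεpos : 0 < (2⁻¹ : ℝ) ^ J.n := by positivity
  have hnd : (0 : ℝ) < (J.n : ℝ) ^ d := by positivity
  have hS1 : (m J.n : ℝ) * (4 * (2⁻¹ : ℝ) ^ J.n) ≤ (1 / (J.n : ℝ) ^ d) / 4 := by
    -- `4 m 2⁻ⁿ ≤ 4 n^{dm} 2⁻ⁿ` and `2ⁿ ≥ 480 n^{d+dm+2} ≥ 16 n^{d+dm}`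
    have hm1 : (m J.n : ℝ) ≤ (J.n : ℝ) ^ dm := by exact_mod_cast hdmn
    have hA : 16 * (J.n : ℝ) ^ (d + dm) ≤ 2 ^ J.n := by
      refine le_trans ?_ h2n
      have hk : (J.n : ℝ) ^ (d + dm) ≤ (J.n : ℝ) ^ (d + dm + 2) := pow_le_pow_right₀ hn1 (by omega)
      have h0 : (0 : ℝ) ≤ (J.n : ℝ) ^ (d + dm) := by positivity
      nlinarith
    rw [show (1 / (J.n : ℝ) ^ d) / 4 = 1 / (4 * (J.n : ℝ) ^ d) by rw [div_div, mul_comm], le_div_iff₀ (by positivity)]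
    calc (m J.n : ℝ) * (4 * (2⁻¹ : ℝ) ^ J.n) * (4 * (J.n : ℝ) ^ d) = 16 * ((m J.n : ℝ) * (J.n : ℝ) ^ d) * (2⁻¹ : ℝ) ^ J.n := by ring
      _ ≤ 16 * ((J.n : ℝ) ^ dm * (J.n : ℝ) ^ d) * (2⁻¹ : ℝ) ^ J.n := by gcongr
      _ = 16 * (J.n : ℝ) ^ (d + dm) * (2⁻¹ : ℝ) ^ J.n := by rw [pow_add]; ring
      _ ≤ 2 ^ J.n * (2⁻¹ : ℝ) ^ J.n := mul_le_mul_of_nonneg_right hA hεpos.le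
      _ = 1 := by rw [mul_comm, hε]
  have hS2 : 3 * ((m J.n : ℝ) * (J.n * (20 / (((p₀.eval J.n : ℕ) : ℝ) + 1)))) ≤ (1 / (J.n : ℝ) ^ d) / 4 := by
    -- `60 m n/(240 n^{d+dm+2} + 1) ≤ 60 n^{dm+1}/(240 n^{d+dm+2}) = 1/(4 n^{d+1}) ≤ 1/(4 n^d)`
    have hm1 : (m J.n : ℝ) ≤ (J.n : ℝ) ^ dm := by exact_mod_cast hdmn
    have hp : ((p₀.eval J.n : ℕ) : ℝ) = 240 * (J.n : ℝ) ^ (d + dm + 2) := by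
      rw [hp₀, eval_mul, eval_C, eval_pow, eval_X]; push_cast; ring
    have hP0 : (0 : ℝ) < ((p₀.eval J.n : ℕ) : ℝ) + 1 := by positivity
    rw [show 3 * ((m J.n : ℝ) * (J.n * (20 / (((p₀.eval J.n : ℕ) : ℝ) + 1)))) = 60 * ((m J.n : ℝ) * J.n) / (((p₀.eval J.n : ℕ) : ℝ) + 1) by ring]
    rw [div_le_iff₀ hP0, show (1 / (J.n : ℝ) ^ d) / 4 * (((p₀.eval J.n : ℕ) : ℝ) + 1) = (((p₀.eval J.n : ℕ) : ℝ) + 1) / (4 * (J.n : ℝ) ^ d) by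
      rw [div_div]; ring, le_div_iff₀ (by positivity), hp]
    calc 60 * ((m J.n : ℝ) * J.n) * (4 * (J.n : ℝ) ^ d) = 240 * ((m J.n : ℝ) * ((J.n : ℝ) * (J.n : ℝ) ^ d)) := by ring
      _ ≤ 240 * ((J.n : ℝ) ^ dm * ((J.n : ℝ) * (J.n : ℝ) ^ d)) := by gcongr
      _ = 240 * (J.n : ℝ) ^ (d + dm + 1) := by rw [show d + dm + 1 = dm + (1 + d) by ring, pow_add, pow_add, pow_one]
      _ ≤ 240 * (J.n : ℝ) ^ (d + dm + 2) := mul_le_mul_of_nonneg_left (pow_le_pow_right₀ hn1 (by omega)) (by norm_num)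
      _ ≤ 240 * (J.n : ℝ) ^ (d + dm + 2) + 1 := by linarith
  -- assemble: `P ≥ δ₁/3 − δ₁/6 = δ₁/6 ≥ 1/(6 n^d) ≥ 1/n^{d+4}`
  have hT : (m J.n : ℝ) * (4 * (2⁻¹ : ℝ) ^ J.n) + 3 * ((m J.n : ℝ) * (J.n * (20 / (((p₀.eval J.n : ℕ) : ℝ) + 1)))) ≤ δ₁ / 2 := by linarith
  have hP : δ₁ / 6 ≤ ((naturalAttemptWith (BU (Umat J)) (NOf J α (N1Of J (q J.n) (⌊β J.n⌋₊ + 1))) (Smod J)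
      (D p₀ J α) (decKernel (K J.n))
      (TshOf J (m J.n) j₀ α (N1Of J (q J.n) (⌊β J.n⌋₊ + 1))) (ellOf J)).toOuterMeasure {u | rawE intE (zOf J u) ∈ J.goodAnswers}).toReal := by
    linarith
  refine le_trans ?_ hP
  have h6 : (6 : ℝ) * (J.n : ℝ) ^ d ≤ (J.n : ℝ) ^ (d + 4) := by
    rw [pow_add]
    have h64 : (6 : ℝ) ≤ (J.n : ℝ) ^ 4 := by
      have : (9 : ℝ) ≤ J.n := by exact_mod_cast hn9
      calc (6 : ℝ) ≤ 9 ^ 4 := by norm_num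
        _ ≤ (J.n : ℝ) ^ 4 := pow_le_pow_left₀ (by norm_num) this 4
    nlinarith
  calc 1 / (J.n : ℝ) ^ (d + 4) ≤ 1 / (6 * (J.n : ℝ) ^ d) := one_div_le_one_div_of_le (by positivity) h6
    _ = (1 / (J.n : ℝ) ^ d) / 6 := by rw [div_div, mul_comm]
    _ ≤ δ₁ / 6 := by linarith

end MRThm59

end Literature.Algebra.EuclideanLattices

end
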